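/-
Copyright (c) 2026. All rights reserved.
Released under Apache 2.0 license as described in the file LICENSE.
Authors: abc-iut cell, wave-6 cone prover seat abc-iut-w6-d036 (gen 5), over abc-iut-w4-d095's genuine §5 settings,
abc-iut-L4-t9's MLF model categories and this seat's functorial containers (see the imports).
-/
import Literature.AnabelianGeometry.AbsoluteAnabelian.AbsTopIII.MLFGaloisMonoAnabelianContainers
import Literature.AnabelianGeometry.AbsoluteAnabelian.AbsTopIII.MLFGaloisModelIdRigid
import Literature.AnabelianGeometry.AbsoluteAnabelian.LogFrobeniusMonoGenuineModel
import Literature.AnabelianGeometry.AbsoluteAnabelian.MonoAnalyticNonarchModel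
import Literature.AlgebraicGeometry.Frobenioids.PadicKummerRelCosetGaloisConj
import HarnessLib

/-!
# [AbsTopIII] Proposition 5.8 (vii) AT THE GENUINE MONO-ANALYTIC MLF MODEL: `An⊢[𝒩⊢⊞_w]`, the equivalence
# `Th⊢[Z] ⥲ An⊢[𝒩⊢⊞_w]` and GENUINE forgetful functors `ψ^{An⊢⊞}_{w,ν}` (no placeholder)

S. Mochizuki, *Topics in absolute anabelian geometry III*, J. Math. Sci. Univ. Tokyo 22 (2015) [MochizukiAbsTopIII2015];
manuscript `paper:url-5493eb38cbb7`: Prop 5.8 (vii) p. 141 l. 37 – p. 142 l. 9 ("Write `An⊢[𝒩⊢⊞_w]` for the category whose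
objects consist of an object of `Th⊢[Z]`, together with the object … given by applying the algorithm “`G ↦ Γ⃗×_non(G)`” of
(ii) … and whose morphisms are the morphisms induced by `Th⊢[Z]`. Thus we obtain a natural equivalence of categories
`Th⊢[Z] ⥲ An⊢[𝒩⊢⊞_w]` together with a “forgetful functor” `ψ^{An⊢⊞}_{w,ν} : An⊢[𝒩⊢⊞_w] → 𝒩⊢⊞_w` … for each vertex `ν` of
`Γ⃗×_w` …, and a natural transformation `ι^{An⊢⊞}_{w,ε}` … for each edge `ε` of `Γ⃗×_w`"), Def 5.6 (ii) p. 135, (iii) p. 136.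

## What this file builds (node [AbsTopIII] Prop 5.8 (vii), layer L4: abc-iut-L4-t3's data-typed rows
`LogFrobeniusSetting.AnMono / κAnMono / ψAnMono`, INHABITED AT THE GENUINE MODEL — no placeholder)

* `galConj`, `galConjEquiv`: conjugation `Gal(ℚ̄_p/k₁) ⥲ Gal(ℚ̄_p/k₂)` by `σ ∈ Gal(ℚ̄_p/ℚ_p)` with `σ(k₁) = k₂`, continuous for
  the Krull topologies; `TFModel.toMonoBase p : 𝒳 = TFModel p ⥤ MonoBase` — the mono-analyticization `Th•[Z] → Th⊢[Z]` at the
  place, `(Π_k ↠ G_k ↷ ℚ̄_p) ↦ (k, ℚ̄_p)`, a Galois-isomorphism of pairs ↦ conjugation by its field component `σ_φ`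
  (abc-iut-L4-t9's rigidity `TFModel.Hom.galois`); `MonoBase` (`MLFGaloisMonoAnabelianContainers.lean`) has ALL
  isomorphisms of topological Galois groups as morphisms, so this functor is not full — the field is forgotten;
* `MLFClosure.AnMono` = PRINT'S `An⊢[𝒩⊢⊞_w]`: objects = an object of the base TOGETHER WITH the `Γ⃗×_non`-datum obtained by
  applying the genuine functorial algorithm (`gammaCross C` = `(G_k ↷ 𝒪^×_k̄) ↪ (G_k ↷ k̄^×)`, a singleton decoration type),
  morphisms induced by the base; `MLFClosure.anMonoEquiv : MonoBase ≌ AnMono` ON THE NOSE (inverse = forgetful functor);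
* `MLFClosure.ψMono` = `ψ^{An⊢⊞}_{w,ν}` GENUINE: `(C, Γ⃗) ↦ (C, (G_k ↷ 𝒪^×_k̄))` / `(C, (G_k ↷ k̄^×))`, on morphisms
  `α ↦ (α, (α, β_α))`, `β_α` the canonical LCFT transport; `ιMonoUnitsToMult` = `ι^{An⊢⊞}_{w,ε}` along `𝒪^× ↪ k̄^×`;
* the §5 setting `LogFrobeniusSetting.nonarchGenuineMonoAn p Vmod isArc` := abc-iut-w4-d095's `nonarchGenuineMono p` with
  `ℰ⊢ := Up MonoBase`, `ℰ• → ℰ⊢ := toMonoBase`, `𝒩⊢⊞_w = 𝒩⊢_w := Up (MonoBase × 𝒞_TS)`, `𝒩_v → 𝒩⊢_v := toMonoBase × TSObj.monoAn`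
  and the genuine Prop 5.8 (vii) rows; theorems: `ψ` lies over `ℰ⊢` on the nose (`nonarchGenuineMonoAn_ψOver`), `hN`/`hκ`
  on the nose, abc-iut-L4-t3's `MonoAnalyticizationHomotopies` inhabited, Cor 5.10 (iv)(a) at the setting.

HONEST LIMITS (named): the perfection vertices `k~ = (𝒪^×)^pf`, `(k̄^×)^pf` are represented by their sources (torsion
quotient not applied); no archimedean component (constant choice, as in abc-iut-w4-d095's settings); `ℰ• := 𝒳`, `An• := 𝒳`
placeholders as there; global theaters = campaign L.  MODEL-LEVEL.  Classical LCFT as proved in the tree; refereed pre-IUT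
material; nothing here bears on [IUTchIII] Cor. 3.12; no side taken.
-/

set_option autoImplicit false

noncomputable section

open CategoryTheory Topology
namespace Literature.AnabelianGeometry.AbsoluteAnabelian

open AbsTopIII
open scoped nonZeroDivisors

/-! ## Part 1. Conjugation `Gal(ℚ̄_p/k₁) ⥲ Gal(ℚ̄_p/k₂)` by `σ ∈ Gal(ℚ̄_p/ℚ_p)` with `σ(k₁) = k₂` -/

section GalConj

variable {p : ℕ} [Fact p.Prime]

/-- Conjugation `τ ↦ σ τ σ⁻¹` by `σ ∈ Gal(ℚ̄_p/ℚ_p)` carrying `k₁` onto `k₂`, as a group homomorphism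
`Gal(ℚ̄_p/k₁) → Gal(ℚ̄_p/k₂)` (the "open injective homomorphism of arithmetic Galois groups" induced by a morphism of pairs,
Def 3.1 (ii), here an isomorphism). [cite: MochizukiAbsTopIII2015, Definition 3.1 (ii) p.67] -/
def galConj (σ : PadicAlgCl p ≃ₐ[ℚ_[p]] PadicAlgCl p) (k₁ k₂ : IntermediateField ℚ_[p] (PadicAlgCl p))
    (h₂₁ : ∀ b : PadicAlgCl p, b ∈ k₂ → σ.symm b ∈ k₁) :
    (PadicAlgCl p ≃ₐ[k₁] PadicAlgCl p) →* (PadicAlgCl p ≃ₐ[k₂] PadicAlgCl p) where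
  toFun τ :=
    { (σ.symm.toRingEquiv.trans ((τ : PadicAlgCl p ≃ₐ[k₁] PadicAlgCl p).toRingEquiv.trans σ.toRingEquiv)) with
      commutes' := fun b => by
        have h : τ (σ.symm (b : PadicAlgCl p)) = σ.symm (b : PadicAlgCl p) :=
          τ.commutes (⟨σ.symm (b : PadicAlgCl p), h₂₁ b b.2⟩ : k₁)
        change σ (τ (σ.symm (b : PadicAlgCl p))) = b
        rw [h]
        exact σ.apply_symm_apply (b : PadicAlgCl p) }
  map_one' := by
    ext x
    change σ ((1 : PadicAlgCl p ≃ₐ[k₁] PadicAlgCl p) (σ.symm x)) = x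
    rw [AlgEquiv.one_apply, AlgEquiv.apply_symm_apply]
  map_mul' τ τ' := by
    ext x
    change σ ((τ * τ') (σ.symm x)) = σ (τ (σ.symm (σ (τ' (σ.symm x)))))
    rw [AlgEquiv.mul_apply, AlgEquiv.symm_apply_apply]

/-- `galConj` on values: `(σ τ σ⁻¹)(x) = σ(τ(σ⁻¹ x))`. [cite: MochizukiAbsTopIII2015, Definition 3.1 (ii) p.67] -/
@[simp] theorem galConj_apply (σ : PadicAlgCl p ≃ₐ[ℚ_[p]] PadicAlgCl p) (k₁ k₂ : IntermediateField ℚ_[p] (PadicAlgCl p))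
    (h₂₁ : ∀ b : PadicAlgCl p, b ∈ k₂ → σ.symm b ∈ k₁) (τ : PadicAlgCl p ≃ₐ[k₁] PadicAlgCl p) (x : PadicAlgCl p) :
    galConj σ k₁ k₂ h₂₁ τ x = σ (τ (σ.symm x)) := rfl

/-- **Conjugation is continuous for the Krull topologies**: `Gal(ℚ̄_p/E)` for `E/k₂` finite pulls back to
`Gal(ℚ̄_p/σ⁻¹E)`, `σ⁻¹E/k₁` finite. [cite: MochizukiAbsTopIII2015, Definition 3.1 (ii) p.67] -/
theorem continuous_galConj (σ : PadicAlgCl p ≃ₐ[ℚ_[p]] PadicAlgCl p) (k₁ k₂ : IntermediateField ℚ_[p] (PadicAlgCl p))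
    [FiniteDimensional ℚ_[p] k₂] (h₁₂ : ∀ a : PadicAlgCl p, a ∈ k₁ → σ a ∈ k₂)
    (h₂₁ : ∀ b : PadicAlgCl p, b ∈ k₂ → σ.symm b ∈ k₁) : Continuous (galConj σ k₁ k₂ h₂₁) := by
  apply continuous_of_continuousAt_one (galConj σ k₁ k₂ h₂₁)
  rw [ContinuousAt, map_one]
  refine Filter.tendsto_def.mpr fun s hs => ?_
  obtain ⟨E, hE, hEs⟩ := (krullTopology_mem_nhds_one_iff k₂ (PadicAlgCl p) s).mp hs
  haveI := hE
  -- `E' := σ⁻¹(E)` as an intermediate field over `ℚ_p`, containing `k₁`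
  let E₀ : IntermediateField ℚ_[p] (PadicAlgCl p) :=
    (E.restrictScalars ℚ_[p]).map (σ.symm : PadicAlgCl p →ₐ[ℚ_[p]] PadicAlgCl p)
  have hk₁ : k₁ ≤ E₀ := by
    intro a ha
    refine ⟨σ a, ?_, σ.symm_apply_apply a⟩
    change σ a ∈ E
    exact E.algebraMap_mem ⟨σ a, h₁₂ a ha⟩
  haveI : FiniteDimensional ℚ_[p] (E.restrictScalars ℚ_[p]) := by
    change FiniteDimensional ℚ_[p] E
    exact Module.Finite.trans k₂ E
  haveI : FiniteDimensional ℚ_[p] E₀ :=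
    LinearEquiv.finiteDimensional
      (IntermediateField.intermediateFieldMap (σ.symm : PadicAlgCl p ≃ₐ[ℚ_[p]] PadicAlgCl p)
        (E.restrictScalars ℚ_[p])).toLinearEquiv
  refine (krullTopology_mem_nhds_one_iff k₁ (PadicAlgCl p) _).mpr
    ⟨IntermediateField.extendScalars hk₁,
      Literature.AlgebraicGeometry.Frobenioids.GaloisConj.finiteDimensional_extendScalars hk₁, ?_⟩
  intro τ hτ
  apply hEs
  rw [SetLike.mem_coe, IntermediateField.mem_fixingSubgroup_iff] at hτ ⊢
  intro y hy
  have hy' : σ.symm y ∈ IntermediateField.extendScalars hk₁ := by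
    change σ.symm y ∈ E₀
    exact ⟨y, hy, rfl⟩
  rw [galConj_apply, hτ _ hy', AlgEquiv.apply_symm_apply]

/-- **Conjugation by `σ` as an isomorphism of topological groups `Gal(ℚ̄_p/k₁) ⥲ Gal(ℚ̄_p/k₂)`** (inverse = conjugation by
`σ⁻¹`). [cite: MochizukiAbsTopIII2015, Definition 3.1 (ii) p.67] -/
def galConjEquiv (σ : PadicAlgCl p ≃ₐ[ℚ_[p]] PadicAlgCl p) (k₁ k₂ : IntermediateField ℚ_[p] (PadicAlgCl p))
    [FiniteDimensional ℚ_[p] k₁] [FiniteDimensional ℚ_[p] k₂] (h₁₂ : ∀ a : PadicAlgCl p, a ∈ k₁ → σ a ∈ k₂)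
    (h₂₁ : ∀ b : PadicAlgCl p, b ∈ k₂ → σ.symm b ∈ k₁) :
    (PadicAlgCl p ≃ₐ[k₁] PadicAlgCl p) ≃ₜ* (PadicAlgCl p ≃ₐ[k₂] PadicAlgCl p) where
  toFun := galConj σ k₁ k₂ h₂₁
  invFun := galConj σ.symm k₂ k₁ (fun a ha => by rw [AlgEquiv.symm_symm]; exact h₁₂ a ha)
  left_inv τ := by
    ext x
    rw [galConj_apply, galConj_apply, AlgEquiv.symm_symm, AlgEquiv.symm_apply_apply, AlgEquiv.symm_apply_apply]
  right_inv τ := by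
    ext x
    rw [galConj_apply, galConj_apply, AlgEquiv.symm_symm, AlgEquiv.apply_symm_apply, AlgEquiv.apply_symm_apply]
  map_mul' := map_mul _
  continuous_toFun := continuous_galConj σ k₁ k₂ h₁₂ h₂₁
  continuous_invFun :=
    continuous_galConj σ.symm k₂ k₁ h₂₁ (fun a ha => by rw [AlgEquiv.symm_symm]; exact h₁₂ a ha)

/-- `galConjEquiv` on values. [cite: MochizukiAbsTopIII2015, Definition 3.1 (ii) p.67] -/
@[simp] theorem galConjEquiv_apply (σ : PadicAlgCl p ≃ₐ[ℚ_[p]] PadicAlgCl p)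
    (k₁ k₂ : IntermediateField ℚ_[p] (PadicAlgCl p)) [FiniteDimensional ℚ_[p] k₁] [FiniteDimensional ℚ_[p] k₂]
    (h₁₂ : ∀ a : PadicAlgCl p, a ∈ k₁ → σ a ∈ k₂) (h₂₁ : ∀ b : PadicAlgCl p, b ∈ k₂ → σ.symm b ∈ k₁)
    (τ : PadicAlgCl p ≃ₐ[k₁] PadicAlgCl p) (x : PadicAlgCl p) :
    galConjEquiv σ k₁ k₂ h₁₂ h₂₁ τ x = σ (τ (σ.symm x)) := rfl

end GalConj

/-! ## Part 2. The mono-analyticization `𝒳 = TFModel p → MonoBase`, `(Π_k ↠ G_k ↷ ℚ̄_p) ↦ (k, ℚ̄_p)` -/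

namespace AbsTopIII.TFModel

variable (p : ℕ) [Fact p.Prime]

variable {p} in
/-- The MLF closure data `(k, ℚ̄_p)` of a model `TF`-pair (abc-iut-L6-d2's local field structure on `k ⊆ ℚ̄_p`,
abc-iut-S1's `IsAlgClosure k ℚ̄_p`). [cite: MochizukiAbsTopIII2015, Definition 5.6 (ii) p.135] -/
def closure (A : TFModel p) : MLFClosure.{0} :=
  letI := PadicAlgCl.subfieldValuativeRel A.k
  haveI := PadicAlgCl.isNonarchimedeanLocalField_subfield A.k
  haveI : CharZero A.k := charZero_of_injective_algebraMap (algebraMap ℚ_[p] A.k).injective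
  haveI := PadicAlgCl.isAlgClosure_subfield A.k
  { k := A.k, K := PadicAlgCl p }

variable {p} in
/-- `σ_φ` carries `k₁` into `k₂`. [cite: MochizukiAbsTopIII2015, Definition 3.1 (ii) p.67] -/
theorem Hom.galois_mem {A B : TFModel p} (f : Hom A B) (a : PadicAlgCl p) (ha : a ∈ A.k) : f.galois a ∈ B.k :=
  f.homM_mem_k ha

variable {p} in
/-- `σ_φ⁻¹` carries `k₂` into `k₁` (apply the previous lemma to the inverse Galois-isomorphism).
[cite: MochizukiAbsTopIII2015, Definition 3.1 (ii) p.67] -/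
theorem Hom.galois_symm_mem {A B : TFModel p} (f : Hom A B) (b : PadicAlgCl p) (hb : b ∈ B.k) :
    f.galois.symm b ∈ A.k := by
  have h := f.inv.homM_mem_k hb
  rwa [Hom.inv_homM_apply] at h

/-- **The mono-analyticization functor `Th•[Z] → Th⊢[Z]` at the place, `W ↦ G_w`** (Def 5.6 (ii)): a model `TF`-pair
`(Π_k ↠ G_k ↷ ℚ̄_p)` goes to the MLF closure data `(k, ℚ̄_p)` — i.e. to `G_k = Gal(ℚ̄_p/k)` as an object of the genuine
mono-analytic base —, a Galois-isomorphism of pairs to conjugation by its field component `σ_φ`.  NOT FULL: the base has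
all isomorphisms of topological groups as morphisms. [cite: MochizukiAbsTopIII2015, Definition 5.6 (ii) p.135] -/
def toMonoBase : TFModel p ⥤ MLFClosure.MonoBase where
  obj A := closure A
  map {A B} f := InducedCategory.homMk
    ⟨galConjEquiv (f : Hom A B).galois A.k B.k (Hom.galois_mem f) (Hom.galois_symm_mem f)⟩
  map_id A := InducedCategory.hom_ext (TopGroupObj.Hom.ext fun (τ : PadicAlgCl p ≃ₐ[A.k] PadicAlgCl p) => by
    apply AlgEquiv.ext
    intro x
    change (𝟙 A : Hom A A).galois (τ ((𝟙 A : Hom A A).galois.symm x)) = τ x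
    have h1 : ∀ y, (𝟙 A : Hom A A).galois y = y := fun y => rfl
    rw [h1]
    congr 1
    exact (𝟙 A : Hom A A).galois.symm_apply_eq.mpr (h1 x).symm)
  map_comp {A B C} f g := InducedCategory.hom_ext (TopGroupObj.Hom.ext fun (τ : PadicAlgCl p ≃ₐ[A.k] PadicAlgCl p) => by
    apply AlgEquiv.ext
    intro (x : PadicAlgCl p)
    have hc : ∀ y, (f ≫ g : Hom A C).galois y = (g : Hom B C).galois ((f : Hom A B).galois y) := fun y => rfl
    have hx : (f ≫ g : Hom A C).galois.symm x = (f : Hom A B).galois.symm ((g : Hom B C).galois.symm x) := by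
      rw [AlgEquiv.symm_apply_eq, hc, AlgEquiv.apply_symm_apply, AlgEquiv.apply_symm_apply]
    change (f ≫ g : Hom A C).galois (τ ((f ≫ g : Hom A C).galois.symm x)) =
      (g : Hom B C).galois ((f : Hom A B).galois (τ ((f : Hom A B).galois.symm ((g : Hom B C).galois.symm x))))
    rw [hc, hx])

variable {p} in
/-- `toMonoBase` on morphisms: conjugation by `σ_φ`. [cite: MochizukiAbsTopIII2015, Definition 5.6 (ii) p.135] -/
theorem toMonoBase_map_iso_apply {A B : TFModel p} (f : A ⟶ B) (τ : PadicAlgCl p ≃ₐ[A.k] PadicAlgCl p) (x : PadicAlgCl p) :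
    (MLFClosure.homIso ((toMonoBase p).map f) τ : PadicAlgCl p ≃ₐ[B.k] PadicAlgCl p) x =
      (f : Hom A B).galois (τ ((f : Hom A B).galois.symm x)) := rfl

end AbsTopIII.TFModel

/-! ## Part 3. `An⊢[𝒩⊢⊞_w]` — print's decorated category — and the equivalence `Th⊢ ⥲ An⊢` on the nose -/

namespace MLFClosure

/-- **The `Γ⃗×_non`-datum of an object of the mono-analytic base** — "the object … given by applying the algorithm
`G ↦ Γ⃗×_non(G)` to `G_w`": the genuine containers `(G_k ↷ 𝒪^×_k̄) ↪ (G_k ↷ k̄^×)` (vertices `𝒪^×`, `k̄^×` and their edge).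
[cite: MochizukiAbsTopIII2015, Prop 5.8 (vii) p.141] -/
def gammaCross (C : MonoBase) : Σ U : TSObj, Σ T : TSObj, (U ⟶ T) :=
  ⟨unitsObj C, timesObj C, kbarUnitsToTimes.app C⟩

/-- **`An⊢[𝒩⊢⊞_w]`** (Prop 5.8 (vii), PRINT'S DEFINITION): "the category whose objects consist of an object of `Th⊢[Z]`,
together with the object … given by applying the algorithm … and whose morphisms are the morphisms induced by `Th⊢[Z]`"
— the category induced along the first projection from pairs `(C, d)`, `d` THE datum `Γ⃗×_non(G_k)`.
[cite: MochizukiAbsTopIII2015, Prop 5.8 (vii) p.141] -/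
abbrev AnMono : Type 1 :=
  InducedCategory MonoBase (Sigma.fst (β := fun C : MonoBase => {d : Σ U : TSObj, Σ T : TSObj, (U ⟶ T) // d = gammaCross C}))

/-- **"Thus we obtain a natural equivalence of categories `Th⊢[Z] ⥲ An⊢[𝒩⊢⊞_w]`"** — ON THE NOSE: `C ↦ (C, Γ⃗×_non(G_k))`,
`f ↦ f`; inverse THE forgetful functor. [cite: MochizukiAbsTopIII2015, Prop 5.8 (vii) p.141] -/
def anMonoEquiv : MonoBase ≌ AnMono :=
  CategoryTheory.Equivalence.mk
    { obj := fun C => ⟨C, ⟨gammaCross C, rfl⟩⟩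
      map := fun f => InducedCategory.homMk f }
    (inducedFunctor _)
    (NatIso.ofComponents (fun C => Iso.refl C) fun f => (Category.comp_id f).trans (Category.id_comp f).symm)
    (NatIso.ofComponents (fun X => InducedCategory.isoMk (Iso.refl X.1)) fun f =>
      InducedCategory.hom_ext ((Category.comp_id f.hom).trans (Category.id_comp f.hom).symm))

/-- The inverse of the equivalence IS the forgetful functor `(C, d) ↦ C`. [cite: MochizukiAbsTopIII2015, Prop 5.8 (vii) p.141] -/
theorem anMonoEquiv_inverse : anMonoEquiv.inverse = inducedFunctor _ := rfl

/-- The containers read at the vertices of `Γ⃗^log_w` on the mono-analytic side: `𝒪^×` at the units vertex, `k̄^×` at the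
multiplicative vertex; HONEST LIMIT: the perfection vertices `k~ = (𝒪^×)^pf`, `(k̄^×)^pf` are represented by their sources
(torsion quotient not applied), the space-link/post-log vertices (no field structure on the mono-analytic side, Prop 5.8
(vii): "for each vertex of `Γ⃗×_w`") and an archimedean `w` (no component in this nonarchimedean model) by `k̄^×`.
[cite: MochizukiAbsTopIII2015, Prop 5.8 (vii) p.142] -/
def monoContainer : (b : Bool) → LogVertex b → (MonoBase ⥤ TSObj)
  | false, .units => kbarUnits
  | false, .shellCod => kbarUnits
  | false, _ => kbarTimes
  | true, _ => kbarTimes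

/-- **`ψ^{An⊢⊞}_{w,ν} : An⊢[𝒩⊢⊞_w] → 𝒩⊢⊞_w = MonoBase × 𝒞_TS`**, GENUINE: `(C, Γ⃗) ↦ (C, (G_k ↷ M_ν))` with `M_ν` the container at
`ν`, on morphisms `α ↦ (α, (α, β_α))`. [cite: MochizukiAbsTopIII2015, Prop 5.8 (vii) p.141] -/
def ψMono (b : Bool) (ν : LogVertex b) : AnMono ⥤ MonoBase × TSObj :=
  inducedFunctor _ ⋙ (𝟭 MonoBase).prod' (monoContainer b ν)

/-- `ψ` lies over the base ON THE NOSE: `ψ_ν ⋙ pr₁ =` the forgetful functor `An⊢ → Th⊢` (the fibred-product leg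
`𝒩⊢⊞_w → Th⊢[Z]` of Def 5.6 (iii)). [cite: MochizukiAbsTopIII2015, Definition 5.6 (iii) p.136] -/
theorem ψMono_fst (b : Bool) (ν : LogVertex b) : ψMono b ν ⋙ CategoryTheory.Prod.fst MonoBase TSObj = inducedFunctor _ := rfl

/-- `ψ` at the multiplicative vertex of a nonarchimedean place reads `(G_k ↷ k̄^×)` off the decoration.
[cite: MochizukiAbsTopIII2015, Prop 5.8 (vii) p.141] -/
theorem ψMono_mult_obj (X : AnMono) :
    (ψMono false NonarchVertex.mult).obj X = (X.1, timesObj X.1) ∧ X.2.1.2.1 = timesObj X.1 :=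
  ⟨rfl, by rw [X.2.2]; rfl⟩

/-- `ψ` at the units vertex reads `(G_k ↷ 𝒪^×_k̄)` off the decoration. [cite: MochizukiAbsTopIII2015, Prop 5.8 (vii) p.141] -/
theorem ψMono_units_obj (X : AnMono) :
    (ψMono false NonarchVertex.units).obj X = (X.1, unitsObj X.1) ∧ X.2.1.1 = unitsObj X.1 :=
  ⟨rfl, by rw [X.2.2]; rfl⟩

/-- **`ψ` on a morphism of `Th⊢[Z]`** — an ARBITRARY isomorphism `α` of topological Galois groups —: the `𝒞_TS`-component is
`(α, β_α)` with `β_α` the canonical local-class-field-theory transport. [cite: MochizukiAbsTopIII2015, Prop 5.8 (vii) p.141] -/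
theorem ψMono_mult_map_homM {X Y : AnMono} (f : X ⟶ Y) (x : ↥(X.1.K)⁰) :
    ((ψMono false NonarchVertex.mult).map f).2.homM x = transport (homIso f.hom) x := rfl

/-- **`ι^{An⊢⊞}_{w,ε}` along the edge `𝒪^× ↪ k̄^×`**: a natural transformation `ψ_{𝒪^×} ⟶ ψ_{k̄^×}` (identity on the base,
the natural inclusion `kbarUnitsToTimes` on the containers). [cite: MochizukiAbsTopIII2015, Prop 5.8 (vii) p.142] -/
def ιMonoUnitsToMult : ψMono false NonarchVertex.units ⟶ ψMono false NonarchVertex.mult :=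
  Functor.whiskerLeft (inducedFunctor _) (NatTrans.prod' (𝟙 (𝟭 MonoBase)) kbarUnitsToTimes)

end MLFClosure

/-! ## Part 4. The §5 setting with GENUINE Prop 5.8 (vii) rows -/

namespace LogFrobeniusSetting

variable (p : ℕ) [Fact p.Prime]

/-- The mono-analyticization `𝒩_v → 𝒩⊢_v` at the model: the base by `toMonoBase`, the local `TS`-pair by abc-iut-w4-d095's
`TSObj.monoAn` `(Π ↷ M) ↦ (G ↷ M)`. [cite: MochizukiAbsTopIII2015, Definition 5.6 (iii) p.136] -/
def nonarchMonoNAn : Up (TFModel p × TSObj) ⥤ Up (MLFClosure.MonoBase × TSObj) :=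
  Up.liftF ((TFModel.toMonoBase p).prod TSObj.monoAn)

/-- **The global log-Frobenius setting with genuine nonarchimedean rows, genuine mono-analytic base AND GENUINE Prop 5.8
(vii) rows** (module docstring): abc-iut-w4-d095's `nonarchGenuineMono p` with `ℰ⊢ := Up MonoBase`, `ℰ• → ℰ⊢ := toMonoBase`,
`𝒩⊢⊞_w = 𝒩⊢_w := Up (MonoBase × 𝒞_TS)`, `An⊢ := Up AnMono` (decorated category), `κ_{An⊢} := anMonoEquiv`, `ψ^{An⊢⊞}_{w,ν} := ψMono`.
[cite: MochizukiAbsTopIII2015, Prop 5.8 (vii) p.141] -/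
def nonarchGenuineMonoAn (Vmod : Type 1) (isArc : Vmod → Bool) : LogFrobeniusSetting Vmod isArc where
  X := Up (TFModel p)
  E := Up (TFModel p)
  proj := 𝟭 _
  log := 𝟭 _
  logIsoId := Iso.refl _
  logOver := Iso.refl _
  Nplus _ := Up (TFModel p × TSObj)
  N _ := Up (TFModel p × TSObj)
  forget _ := 𝟭 _
  toE _ := Up.liftF (CategoryTheory.Prod.fst (TFModel p) TSObj)
  lam v := nonarchLam p (isArc v)
  lamOver v := nonarchLamOver p (isArc v)
  lam_spaceLink_eq_postLog v := nonarchLam_spaceLink_eq_postLog p (isArc v)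
  iota v _ _ ε := nonarchIota p (isArc v) ε
  An := Up (TFModel p)
  κAn := CategoryTheory.Equivalence.refl
  φAn := 𝟭 _
  φAn_isEquivalence := inferInstance
  ηAn := Iso.refl _
  κAn₂ := CategoryTheory.Equivalence.refl
  Emono := Up MLFClosure.MonoBase
  monoAn := Up.liftF (TFModel.toMonoBase p)
  NmonoPlus _ := Up (MLFClosure.MonoBase × TSObj)
  Nmono _ := Up (MLFClosure.MonoBase × TSObj)
  forgetMono _ := 𝟭 _
  toEmono _ := Up.liftF (CategoryTheory.Prod.fst MLFClosure.MonoBase TSObj)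
  monoNplus _ := nonarchMonoNAn p
  monoN _ := nonarchMonoNAn p
  monoHomotopy _ := Iso.refl _
  AnMono := Up MLFClosure.AnMono
  κAnMono := Up.liftE MLFClosure.anMonoEquiv
  ψAnMono w ν := Up.liftF (MLFClosure.ψMono (isArc w) ν.1)

variable (Vmod : Type 1) (isArc : Vmod → Bool)

/-- **`ψ^{An⊢⊞}_{w,ν}` of the setting IS the genuine `ψMono`** (so `MLFClosure.ψMono_mult_obj` / `ψMono_units_obj` /
`ψMono_mult_map_homM` describe it: it reads the vertex of the genuine decoration and acts on morphisms by the canonical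
LCFT transport — no placeholder). [cite: MochizukiAbsTopIII2015, Prop 5.8 (vii) p.141] -/
theorem nonarchGenuineMonoAn_ψAnMono (w : Vmod) (ν : {ν : LogVertex (isArc w) // ν.IsCross}) :
    (nonarchGenuineMonoAn p Vmod isArc).ψAnMono w ν = Up.liftF (MLFClosure.ψMono (isArc w) ν.1) := rfl

/-- **`ψ^{An⊢⊞}_{w,ν}` lies over `ℰ⊢` ON THE NOSE** (the (c)-leg `ψOver` of abc-iut-L4-t3's coherence add-on): for every `w, ν`,
`ψ_ν ⋙ (𝒩⊢⊞_w → 𝒩⊢_w → ℰ⊢) = κ_{An⊢}⁻¹`. [cite: MochizukiAbsTopIII2015, Definition 5.6 (iii) p.136] -/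
theorem nonarchGenuineMonoAn_ψOver (w : Vmod) (ν : {ν : LogVertex (isArc w) // ν.IsCross}) :
    (nonarchGenuineMonoAn p Vmod isArc).ψAnMono w ν ⋙ (nonarchGenuineMonoAn p Vmod isArc).forgetMono w ⋙
        (nonarchGenuineMonoAn p Vmod isArc).toEmono w =
      (nonarchGenuineMonoAn p Vmod isArc).κAnMono.inverse := rfl

/-- rows 4 → 5 (`hN`) ON THE NOSE: `𝒩_v → 𝒩⊢_v → ℰ⊢` and `𝒩_v → ℰ• → ℰ⊢` are the same functor `(A, (Π ↷ M)) ↦ (k_A, ℚ̄_p)`.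
[cite: MochizukiAbsTopIII2015, Cor 5.10 p. 146] -/
theorem nonarchGenuineMonoAn_monoN_toEmono_eq (v : Vmod) :
    (nonarchGenuineMonoAn p Vmod isArc).monoN v ⋙ (nonarchGenuineMonoAn p Vmod isArc).toEmono v =
      (nonarchGenuineMonoAn p Vmod isArc).toE v ⋙ (nonarchGenuineMonoAn p Vmod isArc).monoAn := rfl

/-- rows 6 → 7 (`hκ`) ON THE NOSE. [cite: MochizukiAbsTopIII2015, Cor 5.10 p. 146] -/
theorem nonarchGenuineMonoAn_κAn₂_monoAn_eq :
    (nonarchGenuineMonoAn p Vmod isArc).κAn₂.functor ⋙ (nonarchGenuineMonoAn p Vmod isArc).monoAn =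
      (nonarchGenuineMonoAn p Vmod isArc).κAn.inverse ⋙ (nonarchGenuineMonoAn p Vmod isArc).monoAn := rfl

/-- abc-iut-L4-t3's add-on `MonoAnalyticizationHomotopies` is INHABITED at the setting (`hN` canonical; `anToE` = the unit of
the genuine Prop 5.8 (vii) equivalence). [cite: MochizukiAbsTopIII2015, Cor 5.10 p. 146] -/
def nonarchGenuineMonoAn_monoAnalyticizationHomotopies :
    (nonarchGenuineMonoAn p Vmod isArc).MonoAnalyticizationHomotopies where
  toE v := eqToIso (nonarchGenuineMonoAn_monoN_toEmono_eq p Vmod isArc v)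
  anToE := Functor.isoWhiskerLeft ((nonarchGenuineMonoAn p Vmod isArc).κAn.inverse ⋙ (nonarchGenuineMonoAn p Vmod isArc).monoAn)
    (nonarchGenuineMonoAn p Vmod isArc).κAnMono.unitIso.symm

/-- **[AbsTopIII] Cor 5.10 (iv)(a) HOLDS at the setting with genuine Prop 5.8 (vii) rows** (abc-iut-L4-t3's
`cor510MonoCores_holds` over the inhabited add-on). [cite: MochizukiAbsTopIII2015, Cor 5.10 (iv)(a) p.147] -/
theorem nonarchGenuineMonoAn_cor510MonoCores [Nonempty Vmod] : (nonarchGenuineMonoAn p Vmod isArc).Cor510MonoCores :=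
  cor510MonoCores_holds (nonarchGenuineMonoAn_monoAnalyticizationHomotopies p Vmod isArc)

include p in
/-- **Prop 5.8 (vii) at the genuine model, summary**: a §5 setting with `ℰ⊢` the genuine groupoid of absolute Galois groups,
`An⊢` print's decorated category, `ψ^{An⊢⊞}` over `ℰ⊢` on the nose, at which Cor 5.10 (iv)(a) holds for `V(F_mod) ≠ ∅`.
[cite: MochizukiAbsTopIII2015, Prop 5.8 (vii) p.141] -/
theorem exists_genuine_prop58vii :
    ∃ L : LogFrobeniusSetting Vmod isArc,
      L.Emono = Up MLFClosure.MonoBase ∧ L.AnMono = Up MLFClosure.AnMono ∧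
      (∀ w ν, L.ψAnMono w ν ⋙ L.forgetMono w ⋙ L.toEmono w = L.κAnMono.inverse) ∧
      (Nonempty Vmod → L.Cor510MonoCores) :=
  ⟨nonarchGenuineMonoAn p Vmod isArc, rfl, rfl, nonarchGenuineMonoAn_ψOver p Vmod isArc,
    fun h => haveI := h; nonarchGenuineMonoAn_cor510MonoCores p Vmod isArc⟩

end LogFrobeniusSetting

end Literature.AnabelianGeometry.AbsoluteAnabelian

end
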